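import Literature.Probability.RandomPlanarGeometry.SLEOnePointNonSwallowingProofs
import Literature.Probability.RandomPlanarGeometry.SLEOnePointMartingaleProofs
import HarnessLib

/-!
# SLE phases on the real line: discharge of `Literature.Analysis.FunctionSpaces.sle_swallows_real_iff`

Topic `Analysis/FunctionSpaces`; theorems only. Proof sibling of
`Literature/Analysis/FunctionSpaces/ItoProcesses.lean`, which vendors the named fact
`Literature.Analysis.FunctionSpaces.sle_swallows_real_iff` (Rohde–Schramm (2005), §6: for `κ > 0` and a real
point `x > 0`, `x` is almost surely swallowed by the SLE_κ hulls in finite time iff `κ > 4`;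
Lemma 6.5 for "`⇐`", the proof of Lemma 6.2 for "`⇒`"). This file cannot be appended to
`ItoProcesses` / `ItoProcessesProofs` (the SLE proof files import them), hence the separate
sibling; it only assembles theorems of the tree:

* "`⇐`" (`κ > 4`, Rohde–Schramm Lemma 6.5 / Lawler (2005) Prop. 6.8, second item): Lawler's
  optional-stopping argument `sle_swallowingTime_lt_top_of_onePointMartingales`
  (`SLEOnePointSwallowingProofs`) from the one-point martingales `(X_{t∧σ})^{1-4/κ}` and
  `(X_{t∧σ})² - (4+κ)(t∧σ)`, whose Itô steps are the theorems `sle_martingale_onePointPow_holds`,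
  `sle_martingale_onePointSq_holds` (`SLEOnePointMartingaleProofs`), instances of the
  generator-martingale theorem `martingale_generator_sleRealFlowStop` (`SLERealFlowGenerator`; the
  stopped real flow is an Itô process, `SLERealFlowIto`; Itô's formula
  `ito_formula_itoProcess_ae_holds`, `ItoFormulaProofs`);
* "`⇒`" (`κ ≤ 4`, Rohde–Schramm proof of Lemma 6.2 / Lawler Prop. 6.8, first item):
  `ae_sle_swallowingTime_eq_top_of_le_four` (`SLEOnePointNonSwallowingProofs`): a.s. `T_x = ∞`,
  incompatible with a.s. finiteness under the (probability) Wiener measure; both directions are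
  combined there as `sle_swallows_real_iff_of_onePointMartingales`.

## References

* S. Rohde, O. Schramm, *Basic properties of SLE*, Ann. of Math. 161 (2005), §6, Lemma 6.2 (and
  its proof: `F̂(x) = x^{(κ-4)/κ}`, `log x`; "`F(x) → 1` when `a ↘ 0`"), Lemma 6.5 ("Let
  `z ∈ H̄ ∖ {0}`. If `κ > 4`, then `P[τ(z) < ∞] = 1`").
* G. F. Lawler, *Conformally Invariant Processes in the Plane*, AMS (2005), Prop. 1.21, Prop. 6.8.
-/

noncomputable section

namespace Literature.Analysis.FunctionSpaces

open Literature.Probability.RandomPlanarGeometry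

/-- **Discharge of `sle_swallows_real_iff`** (SLE phases on the real line; Rohde–Schramm (2005),
§6: Lemma 6.5 for "`⇐`" and the proof of Lemma 6.2 for "`⇒`"): for `κ > 0` and `x > 0`, the
point `x` is almost surely swallowed in finite time (`T_x < ∞` a.s. under the Wiener measure) iff
`κ > 4`. Assembled from `sle_swallows_real_iff_of_onePointMartingales`
(`SLEOnePointNonSwallowingProofs`: "`⇒`" proved there, "`⇐`" reduced to the two one-point Itô
steps by `SLEOnePointSwallowingProofs`) and the discharged Itô steps
`sle_martingale_onePointPow_holds`, `sle_martingale_onePointSq_holds`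
(`SLEOnePointMartingaleProofs`). [cite: RohdeSchramm2005, §6 Lemma 6.5 and proof of Lemma 6.2] -/
theorem sle_swallows_real_iff_holds : sle_swallows_real_iff :=
  sle_swallows_real_iff_of_onePointMartingales sle_martingale_onePointPow_holds
    sle_martingale_onePointSq_holds

end Literature.Analysis.FunctionSpaces
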